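import Summits.QuantumAdvantage.AdviceFreeQNC0.WalkTransport
import HarnessLib

/-!
# Sketch24 (planner qn-p1 g24, ROUND-23 §3; ask P-24a): fibre-exact rigidity for the (NP₀) rung — the TOP-COEFFICIENT
# FORMULA and the EXPOSED-SUPPORT LEMMA on the full cube, PROVED

The statements of `HOME/qa-qnc0-p1/exp24/Sketch24.lean` (planner seat qn-p1 g24) are repeated VERBATIM (`test`, `supp`,
`xorTests`, `parityClass`, `Exposed`, `ExposedSupportLemma`, `ExposedSupportLemmaCube`, `TopCoeffFormula`,
`FullSupportRigidity`).  PROVED here (prover seat qn-prover-3 g13):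

* `nSub_mod_two` — the top 𝔽₂-coefficient in Finset form: for a NONEMPTY `S` on which `γ` has no zero,
  `#{U ⊆ S : Σ_{e∈U} γ_e = c} ≡ [c + Σ_{e∈S} γ_e ≠ 0] (mod 2)` (Finset induction; step `[r≠0] + [r−b≠0] ≡ [r+b≠0]` for
  `b ≠ 0` in `ZMod 3`; base `|S| = 1`);
* **`not_topCoeffFormula : ¬ TopCoeffFormula`** — AS TYPED the formula fails in the degenerate case `Z = 0` (the empty
  test `[0 = c]` fires on the unique point iff `c = 0`, while `c + 0 ≠ 0` says the opposite); the repaired statement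
  **`topCoeffFormulaPos : TopCoeffFormulaPos`** (`0 < Z` added, otherwise verbatim) is PROVED;
* **`exposedSupportLemmaCube : ExposedSupportLemmaCube`** — an XOR of MOD₃ tests one of whose rows `g₀` has support `S`,
  `|S| ≥ 2`, with every other row missing `≥ 2` elements of `S`, is NOT constant on the cube.  PROOF (planner's route,
  ROUND-23 §3.2): the 𝔽₂-coefficient of the monomial `y_T` of a Boolean function is the parity `Σ_{U⊆T} F(1_U)`
  (`coeff`); it is additive over XOR (`coeff_xorTests`), vanishes for `T ≠ ∅` on constants (`coeff_const`) and for a test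
  whose support misses a point of `T` (`card_filter_test_even`, the involution `U ↦ U △ {e}`); for `T = S` and `T = S ∖ e`
  only the row `g₀` survives, and `nSub_mod_two` gives `c + Σ_S γ = 0 = c + Σ_{S∖e} γ`, i.e. `γ_e = 0`, absurd.

The parity-class version `ExposedSupportLemma` (M+, needs the `e₀`-elimination of ROUND-23 §3.2) and `FullSupportRigidity`
(conjectural, data-supported only) are NOT proved here.
WHAT THIS IS NOT: instrument for the (NP₀) rung of plan S2 / crux stmt-QuantumAdvantage-22907 (route DWalkThree, p = 3 side);
no 99 %-regime bound; separation NOT moved.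
-/

namespace Summit.QuantumAdvantage.AdviceFreeQNC0

namespace AffBells24

open Finset

/-! ### Statements (Sketch24, verbatim) -/

/-- The MOD₃ test `[∑_{e : y e} γ e = c]` on the Boolean cube `Fin Z → Bool`. -/
def test {Z : ℕ} (γ : Fin Z → ZMod 3) (c : ZMod 3) (y : Fin Z → Bool) : Bool :=
  decide ((∑ e, if y e then γ e else 0) = c)

/-- Support of a coefficient vector. -/
def supp {Z : ℕ} (γ : Fin Z → ZMod 3) : Finset (Fin Z) :=
  univ.filter fun e => γ e ≠ 0

/-- XOR (parity of the number of firing tests) of a family of `K` tests. -/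
def xorTests {Z K : ℕ} (γ : Fin K → Fin Z → ZMod 3) (c : Fin K → ZMod 3)
    (y : Fin Z → Bool) : Bool :=
  decide ((univ.filter fun g => test (γ g) (c g) y = true).card % 2 = 1)

/-- The parity class `{y : #ones(y) ≡ σ (mod 2)}` of the cube (a fibre's coin cube). -/
def parityClass (Z σ : ℕ) : Finset (Fin Z → Bool) :=
  univ.filter fun y => (univ.filter fun e => y e = true).card % 2 = σ % 2

/-- Row `g₀` is *exposed* in the family `γ`: `3 ≤ |S| ≤ Z - 1` for `S = supp (γ g₀)` and every
other row misses at least three elements of `S`. -/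
def Exposed {Z K : ℕ} (γ : Fin K → Fin Z → ZMod 3) (g₀ : Fin K) : Prop :=
  3 ≤ (supp (γ g₀)).card ∧ (supp (γ g₀)).card + 1 ≤ Z ∧
    ∀ g, g ≠ g₀ → 3 ≤ (supp (γ g₀) \ supp (γ g)).card

/-- EXPOSED-SUPPORT LEMMA (conjectured in general; verified exhaustively for `Z ≤ 6`):
an XOR family with an exposed row is not constant on any parity class. -/
def ExposedSupportLemma : Prop :=
  ∀ (Z K σ : ℕ) (γ : Fin K → Fin Z → ZMod 3) (c : Fin K → ZMod 3) (g₀ : Fin K),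
    Exposed γ g₀ → ∀ b : Bool, ∃ y ∈ parityClass Z σ, xorTests γ c y ≠ b

/-- Full-cube variant (threshold 2, full support allowed; verified `Z ≤ 6`). -/
def ExposedSupportLemmaCube : Prop :=
  ∀ (Z K : ℕ) (γ : Fin K → Fin Z → ZMod 3) (c : Fin K → ZMod 3) (g₀ : Fin K),
    2 ≤ (supp (γ g₀)).card → (∀ g, g ≠ g₀ → 2 ≤ (supp (γ g₀) \ supp (γ g)).card) →
      ∀ b : Bool, ∃ y : Fin Z → Bool, xorTests γ c y ≠ b

/-- TOP-COEFFICIENT FORMULA (verified `Z ≤ 8`): for a full-support test, the 𝔽₂-coefficient of the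
top monomial `∏ y_e`, i.e. the parity of `#{y : test fires}`, is `[c + ∑ γ ≠ 0]`. -/
def TopCoeffFormula : Prop :=
  ∀ (Z : ℕ) (γ : Fin Z → ZMod 3) (c : ZMod 3), (∀ e, γ e ≠ 0) →
    ((univ.filter fun y : Fin Z → Bool => test γ c y = true).card % 2 = 1 ↔ c + ∑ e, γ e ≠ 0)

/-- FULL-SUPPORT SHORT-RELATION RIGIDITY (conjectural shape; data: no non-R1 relation of weight ≤ 6
among full-support tests on a parity class for `Z = 7, 8`; weight-4 ones exist for `Z = 5, 6`):
for every `K₀` there is `Z₀` such that on `Z ≥ Z₀` coins, a constant XOR of `K ≤ K₀` full-support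
tests on a parity class is *trivial*: after cancelling equal tests in pairs, the remaining tests
group into parallel triples `{(γ, c), (±γ, ·), (±γ, ·)}` exhausting the three residues. Stated here
only in its simplest consequence: a single full-support test is not cancelled by fewer than `K₀`
pairwise distinct other full-support tests unless one of them is parallel to it. -/
def FullSupportRigidity (K₀ Z₀ : ℕ) : Prop :=
  ∀ (Z K σ : ℕ), Z₀ ≤ Z → K ≤ K₀ →
    ∀ (γ : Fin K → Fin Z → ZMod 3) (c : Fin K → ZMod 3) (g₀ : Fin K),
      (∀ g e, γ g e ≠ 0) →
      (∀ g, g ≠ g₀ → ¬ (γ g = γ g₀ ∨ γ g = -γ g₀)) →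
        ∀ b : Bool, ∃ y ∈ parityClass Z σ, xorTests γ c y ≠ b

/-! ### The top coefficient in Finset form -/

variable {Z : ℕ}

/-- Number of subsets `U ⊆ S` on which the test `[Σ_{e∈U} γ_e = c]` fires. -/
def nSub (S : Finset (Fin Z)) (γ : Fin Z → ZMod 3) (c : ZMod 3) : ℕ :=
  (S.powerset.filter fun U => ∑ e ∈ U, γ e = c).card

/-- The empty support: only `U = ∅`, which fires iff `c = 0`. -/
theorem nSub_empty (γ : Fin Z → ZMod 3) (c : ZMod 3) : nSub ∅ γ c = if c = 0 then 1 else 0 := by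
  unfold nSub
  rw [Finset.powerset_empty, Finset.filter_singleton, Finset.sum_empty]
  by_cases h : c = 0
  · rw [if_pos h.symm, if_pos h, card_singleton]
  · rw [if_neg (Ne.symm h), if_neg h, card_empty]

/-- Splitting off one element of the support: `U ∌ a` or `U = insert a U'`. -/
theorem nSub_insert {S : Finset (Fin Z)} {a : Fin Z} (ha : a ∉ S) (γ : Fin Z → ZMod 3) (c : ZMod 3) :
    nSub (insert a S) γ c = nSub S γ c + nSub S γ (c - γ a) := by
  classical
  unfold nSub
  rw [Finset.powerset_insert, Finset.filter_union, Finset.card_union_of_disjoint]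
  · congr 1
    rw [Finset.filter_image, Finset.card_image_of_injOn]
    · congr 1
      ext U
      simp only [mem_filter, mem_powerset, and_congr_right_iff]
      intro hU
      have haU : a ∉ U := fun h => ha (hU h)
      rw [Finset.sum_insert haU]
      constructor
      · intro h; rw [← h]; ring
      · intro h; rw [h]; ring
    · intro U hU U' hU' h
      rw [mem_coe, mem_filter, mem_powerset] at hU hU'
      have haU : a ∉ U := fun hh => ha (hU.1 hh)
      have haU' : a ∉ U' := fun hh => ha (hU'.1 hh)
      rw [← Finset.erase_insert haU, ← Finset.erase_insert haU', h]
  · rw [Finset.disjoint_left]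
    intro U hU hU'
    rw [mem_filter, mem_powerset] at hU
    rw [mem_filter, Finset.mem_image] at hU'
    obtain ⟨U', _, rfl⟩ := hU'.1
    exact ha (hU.1 (mem_insert_self a U'))

/-- The 3-case step in `ZMod 3`: for `b ≠ 0`, `[r ≠ 0] + [r − b ≠ 0] ≡ [r + b ≠ 0] (mod 2)`. -/
private theorem step_three : ∀ r b : ZMod 3, b ≠ 0 →
    ((if r ≠ 0 then 1 else 0) + (if r - b ≠ 0 then 1 else 0)) % 2 = (if r + b ≠ 0 then 1 else 0 : ℕ) := by
  decide

/-- The base case `|S| = 1`: `[c = 0] + [c = b] ≡ [c + b ≠ 0]` for `b ≠ 0`. -/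
private theorem base_three : ∀ c b : ZMod 3, b ≠ 0 →
    ((if c = 0 then 1 else 0) + (if c - b = 0 then 1 else 0)) % 2 = (if c + b ≠ 0 then 1 else 0 : ℕ) := by
  decide

/-- **Top coefficient, Finset form**: on a nonempty `S` where `γ` has no zero, the number of subsets `U ⊆ S` with
`Σ_{e∈U} γ_e = c` is odd iff `c + Σ_{e∈S} γ_e ≠ 0`. -/
theorem nSub_mod_two (S : Finset (Fin Z)) (hS : S.Nonempty) (γ : Fin Z → ZMod 3) (hγ : ∀ e ∈ S, γ e ≠ 0)
    (c : ZMod 3) : nSub S γ c % 2 = if c + ∑ e ∈ S, γ e ≠ 0 then 1 else 0 := by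
  classical
  induction S using Finset.induction_on generalizing c with
  | empty => exact absurd hS Finset.not_nonempty_empty
  | insert a S ha ih =>
    rw [nSub_insert ha, Finset.sum_insert ha]
    have hγa : γ a ≠ 0 := hγ a (mem_insert_self a S)
    by_cases hS0 : S = ∅
    · subst hS0
      rw [nSub_empty, nSub_empty, Finset.sum_empty, add_zero]
      exact base_three c (γ a) hγa
    · have hSne : S.Nonempty := Finset.nonempty_iff_ne_empty.2 hS0
      have hγS : ∀ e ∈ S, γ e ≠ 0 := fun e he => hγ e (mem_insert_of_mem he)
      rw [Nat.add_mod, ih hSne hγS c, ih hSne hγS (c - γ a)]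
      have e1 : c - γ a + ∑ e ∈ S, γ e = (c + ∑ e ∈ S, γ e) - γ a := by ring
      have e2 : c + (γ a + ∑ e ∈ S, γ e) = (c + ∑ e ∈ S, γ e) + γ a := by ring
      rw [e1, e2]
      exact step_three _ _ hγa

/-! ### The typed top-coefficient formula: false at `Z = 0`, true for `Z ≥ 1` -/

/-- **`TopCoeffFormula` as typed is FALSE** (degenerate case `Z = 0`, `c = 0`: the empty test fires on the unique point,
an odd count, while `c + 0 ≠ 0` fails). -/
theorem not_topCoeffFormula : ¬ TopCoeffFormula := by
  intro h
  have h0 := h 0 (fun e => e.elim0) 0 (fun e => e.elim0)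
  have lhs : (univ.filter fun y : Fin 0 → Bool => test (fun e => e.elim0) 0 y = true).card % 2 = 1 := by
    decide
  exact absurd (h0.1 lhs) (by decide)

/-- The repaired statement: `TopCoeffFormula` for `Z ≥ 1` (otherwise verbatim). -/
def TopCoeffFormulaPos : Prop :=
  ∀ (Z : ℕ), 0 < Z → ∀ (γ : Fin Z → ZMod 3) (c : ZMod 3), (∀ e, γ e ≠ 0) →
    ((univ.filter fun y : Fin Z → Bool => test γ c y = true).card % 2 = 1 ↔ c + ∑ e, γ e ≠ 0)

/-- Points of the cube versus subsets: the firing points of a test are in bijection with the firing subsets. -/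
theorem card_filter_test_eq_nSub (γ : Fin Z → ZMod 3) (c : ZMod 3) :
    (univ.filter fun y : Fin Z → Bool => test γ c y = true).card = nSub univ γ c := by
  classical
  unfold nSub
  refine Finset.card_bij (fun y _ => univ.filter fun e => y e = true) ?_ ?_ ?_
  · intro y hy
    rw [mem_filter] at hy
    rw [mem_filter, mem_powerset]
    refine ⟨filter_subset _ _, ?_⟩
    have h := hy.2
    unfold test at h
    rw [decide_eq_true_eq] at h
    rw [Finset.sum_filter]
    exact h
  · intro y₁ _ y₂ _ h
    funext e
    have h1 : e ∈ (univ.filter fun e => y₁ e = true) ↔ e ∈ (univ.filter fun e => y₂ e = true) := by rw [h]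
    simp only [mem_filter, mem_univ, true_and] at h1
    cases h₁ : y₁ e <;> cases h₂ : y₂ e
    · rfl
    · exact absurd (h1.2 h₂) (by rw [h₁]; decide)
    · exact absurd (h1.1 h₁) (by rw [h₂]; decide)
    · rfl
  · intro U hU
    rw [mem_filter, mem_powerset] at hU
    refine ⟨fun e => decide (e ∈ U), ?_, ?_⟩
    · rw [mem_filter]
      refine ⟨mem_univ _, ?_⟩
      unfold test
      rw [decide_eq_true_eq]
      have e1 : (univ.filter fun e : Fin Z => decide (e ∈ U) = true) = U := by
        ext e; simp
      rw [← hU.2, ← e1, Finset.sum_filter, e1]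
    · ext e; simp

/-- **`TopCoeffFormulaPos` — PROVED** (the planner's formula with `0 < Z`). -/
theorem topCoeffFormulaPos : TopCoeffFormulaPos := by
  intro Z hZ γ c hγ
  rw [card_filter_test_eq_nSub,
    nSub_mod_two univ (Finset.univ_nonempty_iff.2 ⟨⟨0, hZ⟩⟩) γ (fun e _ => hγ e) c]
  by_cases h : c + ∑ e, γ e ≠ 0
  · rw [if_pos h]; exact ⟨fun _ => h, fun _ => rfl⟩
  · rw [if_neg h]; exact ⟨fun h0 => absurd h0 (by decide), fun h' => absurd h' h⟩

/-! ### 𝔽₂-coefficients of Boolean functions on the cube (as parities over sub-cubes) -/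

/-- Indicator vector of a finset of coordinates. -/
def ind (U : Finset (Fin Z)) : Fin Z → Bool := fun e => decide (e ∈ U)

/-- A test at an indicator point fires iff the subset sum hits `c`. -/
theorem test_ind (γ : Fin Z → ZMod 3) (c : ZMod 3) (U : Finset (Fin Z)) :
    test γ c (ind U) = decide (∑ e ∈ U, γ e = c) := by
  classical
  unfold test ind
  have e1 : (univ.filter fun e : Fin Z => decide (e ∈ U) = true) = U := by ext e; simp
  have hsum : (∑ e : Fin Z, if decide (e ∈ U) = true then γ e else 0) = ∑ e ∈ U, γ e := by
    rw [← Finset.sum_filter, e1]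
  rw [hsum]

/-- The 𝔽₂-coefficient of the monomial `y_T` of `F`, as the parity `Σ_{U ⊆ T} F(1_U) mod 2`. -/
def coeff (T : Finset (Fin Z)) (F : (Fin Z → Bool) → Bool) : ℕ :=
  (T.powerset.filter fun U => F (ind U) = true).card % 2

/-- Constants have no non-empty monomials. -/
theorem coeff_const {F : (Fin Z → Bool) → Bool} {b : Bool} (hF : ∀ y, F y = b) {T : Finset (Fin Z)}
    (hT : T.Nonempty) : coeff T F = 0 := by
  unfold coeff
  obtain ⟨k, hk⟩ : ∃ k, T.card = k + 1 := ⟨T.card - 1, by have := hT.card_pos; omega⟩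
  cases b
  · rw [Finset.filter_false_of_mem (fun U _ => by rw [hF]; decide), card_empty]
  · rw [Finset.filter_true_of_mem (fun U _ => hF _), Finset.card_powerset, hk, pow_succ]
    exact Nat.mul_mod_left _ _

/-- Parity of the number of odd counts = parity of the total count. -/
private theorem card_filter_odd_mod_two' {ι : Type*} (s : Finset ι) (cnt : ι → ℕ) :
    (s.filter fun j => cnt j % 2 = 1).card % 2 = (∑ j ∈ s, cnt j) % 2 := by
  rw [Finset.sum_nat_mod, Finset.card_filter]
  congr 1
  refine Finset.sum_congr rfl fun j _ => ?_
  rcases Nat.mod_two_eq_zero_or_one (cnt j) with h | h <;> simp [h]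

/-- **Additivity over XOR**: the coefficient of an XOR of tests is the sum of the coefficients of the tests (mod 2). -/
theorem coeff_xorTests {K : ℕ} (γ : Fin K → Fin Z → ZMod 3) (c : Fin K → ZMod 3) (T : Finset (Fin Z)) :
    coeff T (xorTests γ c) =
      (∑ g : Fin K, (T.powerset.filter fun U => test (γ g) (c g) (ind U) = true).card) % 2 := by
  unfold coeff
  have e1 : (T.powerset.filter fun U => xorTests γ c (ind U) = true) =
      T.powerset.filter fun U => (univ.filter fun g => test (γ g) (c g) (ind U) = true).card % 2 = 1 := by
    refine filter_congr fun U _ => ?_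
    unfold xorTests
    rw [decide_eq_true_eq]
  rw [e1, card_filter_odd_mod_two']
  congr 1
  simp_rw [Finset.card_filter]
  exact Finset.sum_comm

/-- **A test whose support misses a point `e ∈ T` has even count on the sub-cube of `T`** (the involution `U ↦ U △ {e}`
preserves the subset sum). -/
theorem card_filter_test_even (γ : Fin Z → ZMod 3) (c : ZMod 3) {T : Finset (Fin Z)} {e : Fin Z} (he : e ∈ T)
    (hγe : γ e = 0) : (T.powerset.filter fun U => test γ c (ind U) = true).card % 2 = 0 := by
  classical
  set P : Finset (Fin Z) → Prop := fun U => test γ c (ind U) = true with hP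
  have heT : e ∉ T.erase e := Finset.notMem_erase e T
  have hsplit : T.powerset = (T.erase e).powerset ∪ ((T.erase e).powerset.image (insert e)) := by
    rw [← Finset.powerset_insert, Finset.insert_erase he]
  have hdisj : Disjoint ((T.erase e).powerset.filter P) (((T.erase e).powerset.image (insert e)).filter P) := by
    rw [Finset.disjoint_left]
    intro U hU hU'
    rw [mem_filter, mem_powerset] at hU
    rw [mem_filter, Finset.mem_image] at hU'
    obtain ⟨U', _, rfl⟩ := hU'.1
    exact heT (hU.1 (mem_insert_self e U'))
  have hsame : (((T.erase e).powerset.image (insert e)).filter P).card = ((T.erase e).powerset.filter P).card := by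
    rw [Finset.filter_image, Finset.card_image_of_injOn]
    · congr 1
      refine filter_congr fun U hU => ?_
      rw [mem_powerset] at hU
      have heU : e ∉ U := fun h => heT (hU h)
      simp only [hP, test_ind, Finset.sum_insert heU, hγe, zero_add]
    · intro U hU U' hU' h
      rw [mem_coe, mem_filter, mem_powerset] at hU hU'
      have heU : e ∉ U := fun hh => heT (hU.1 hh)
      have heU' : e ∉ U' := fun hh => heT (hU'.1 hh)
      rw [← Finset.erase_insert heU, ← Finset.erase_insert heU', h]
  rw [hsplit, Finset.filter_union, Finset.card_union_of_disjoint hdisj, hsame]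
  omega

/-- On a sub-cube of the support the firing count of a test is `nSub`. -/
theorem card_filter_test_eq (γ : Fin Z → ZMod 3) (c : ZMod 3) (T : Finset (Fin Z)) :
    (T.powerset.filter fun U => test γ c (ind U) = true).card = nSub T γ c := by
  unfold nSub
  congr 1
  refine filter_congr fun U _ => ?_
  rw [test_ind, decide_eq_true_eq]

/-! ### The exposed-support lemma on the full cube -/

/-- **`ExposedSupportLemmaCube` — PROVED.** -/
theorem exposedSupportLemmaCube : ExposedSupportLemmaCube := by
  intro Z K γ c g₀ hS hmiss b
  classical
  by_contra hcon
  push Not at hcon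
  set S := supp (γ g₀) with hSdef
  have hγS : ∀ x ∈ S, γ g₀ x ≠ 0 := fun x hx => (mem_filter.1 hx).2
  have hSne : S.Nonempty := card_pos.1 (by omega)
  obtain ⟨e, he⟩ := hSne
  -- on the sub-cubes of `T = S` and `T = S ∖ e` only the row `g₀` has a non-zero coefficient
  have key : ∀ T : Finset (Fin Z), T ⊆ S → T.Nonempty → S.card ≤ T.card + 1 →
      nSub T (γ g₀) (c g₀) % 2 = 0 := by
    intro T hTS hTne hTcard
    have h0 : coeff T (xorTests γ c) = 0 := coeff_const hcon hTne
    rw [coeff_xorTests] at h0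
    have hothers : ∀ g, g ≠ g₀ → (T.powerset.filter fun U => test (γ g) (c g) (ind U) = true).card % 2 = 0 := by
      intro g hg
      -- some point of `T` is missed by the support of row `g`
      obtain ⟨e', he'T, hγe'⟩ : ∃ e' ∈ T, γ g e' = 0 := by
        by_contra hne
        push Not at hne
        have hsub : S \ supp (γ g) ⊆ S \ T := by
          intro x hx
          rw [mem_sdiff] at hx ⊢
          refine ⟨hx.1, fun hxT => hx.2 ?_⟩
          exact mem_filter.2 ⟨mem_univ _, hne x hxT⟩
        have h1 := card_le_card hsub
        rw [card_sdiff_of_subset hTS] at h1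
        have h2 := hmiss g hg
        omega
      exact card_filter_test_even (γ g) (c g) he'T hγe'
    rw [← Finset.add_sum_erase univ _ (mem_univ g₀), Nat.add_mod, Finset.sum_nat_mod,
      Finset.sum_eq_zero (fun g hg => hothers g (Finset.ne_of_mem_erase hg)), Nat.zero_mod, add_zero,
      Nat.mod_mod, card_filter_test_eq] at h0
    exact h0
  have h1 := key S subset_rfl ⟨e, he⟩ (by omega)
  have h2 := key (S.erase e) (erase_subset _ _)
    (by rw [← card_pos, card_erase_of_mem he]; omega) (by rw [card_erase_of_mem he]; omega)
  rw [nSub_mod_two S ⟨e, he⟩ (γ g₀) hγS] at h1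
  rw [nSub_mod_two (S.erase e) (by rw [← card_pos, card_erase_of_mem he]; omega) (γ g₀)
    (fun x hx => hγS x (mem_of_mem_erase hx))] at h2
  have h1' : c g₀ + ∑ x ∈ S, γ g₀ x = 0 := by
    by_contra h; rw [if_pos h] at h1; exact absurd h1 (by decide)
  have h2' : c g₀ + ∑ x ∈ S.erase e, γ g₀ x = 0 := by
    by_contra h; rw [if_pos h] at h2; exact absurd h2 (by decide)
  have hsum : (∑ x ∈ S, γ g₀ x) = γ g₀ e + ∑ x ∈ S.erase e, γ g₀ x := (Finset.add_sum_erase S _ he).symm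
  have hγe : γ g₀ e = 0 := by
    rw [hsum] at h1'
    linear_combination h1' - h2'
  exact hγS e he hγe

end AffBells24

end Summit.QuantumAdvantage.AdviceFreeQNC0
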